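import Literature.AlgebraicGeometry.HodgeTheory.WeilClassesFourfoldsProofs
import Literature.AlgebraicGeometry.HodgeTheory.GysinBaseChange
import Literature.AlgebraicGeometry.Motives.AbelianVarietyProjectiveChart
import Literature.AlgebraicGeometry.Motives.VarietiesUnitProofs
import Summits.HodgeConjecture.HodgeConjecture.Theorems.HeckePrymWeilHeckePrymAnchorsPointClassPolynomial
import HarnessLib

/-!
# Crux `HeckePrymAnchors` (stmt-HodgeConjecture-14496), line `Sketch` · stub A1, part 2: polynomiality of pull-backs

Route `HeckePrymWeil`, stub `stub_pointClassAnchor`. On the REAL carriers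
`complexBetti A.X d = Hᵈ(A(ℂ); ℂ)` of a complex abelian variety `A` the tree has neither
`H•(A(ℂ)) = ⋀• H¹` (the named fact `Motives.abelianVarietyCohomologyExteriorH1`) nor the weight
decomposition `[n]^* = nᵈ` on `Hᵈ`. This file PROVES the weak, degree-free form of the latter that
the split anchor needs, from the tree's proved Künneth SPANNING theorem for `(A × A)(ℂ)`
(`kunnethSpan_complexBetti`, Hatcher Thm. 3.15) and Mumford's argument (*Abelian Varieties* §1:
`(f + g)^* = Δ^* (f × g)^* m^*`):

* `pca_coprod` — the **coproduct formula**: for `y ∈ Hᵈ(A(ℂ))` there are finitely many classes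
  `y'ᵢ ∈ H^{aᵢ}(A(ℂ))`, `y''ᵢ ∈ H^{bᵢ}(A(ℂ))`, `aᵢ + bᵢ = d`, with
  `(f + g)^* y = Σᵢ f^* y'ᵢ ∪ g^* y''ᵢ` for ALL homomorphisms `f, g : B ⟶ A`;
* `pca_nsmul_poly` — **`n ↦ [n]^* y` is a polynomial function of `n ∈ ℕ`** with coefficients in
  `Hᵈ(A(ℂ))` (induction on `d`: `[n+1]^* y - [n]^* y` only involves `[n]^*` in degrees `< d`, because
  the bidegree-`(d, 0)` part of `m^* y` is `y ⊗ 1` — the neutral element kills positive degrees,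
  `H^{>0}(Spec ℂ (ℂ)) = 0`, and `H⁰(A(ℂ)) = ℂ · 1`; then Faulhaber);
* `pca_poly₂_map_add` — **`(u, w) ↦ (f₀ + u·f₁ + w·f₂)^* c` is a polynomial function on `ℕ × ℕ`**
  with coefficients in `Hᵈ(B(ℂ))`, for any `f₀, f₁, f₂ : B ⟶ A`.
-/

noncomputable section
-- every declaration of this problem lives in Summit.HodgeConjecture.HodgeConjecture.… (summit = sub-problem)
set_option linter.dupNamespace false

open CategoryTheory AlgebraicGeometry MonoidalCategory CartesianMonoidalCategory
open Literature.AlgebraicGeometry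

namespace Summit.HodgeConjecture.HodgeConjecture.Theorems.HeckePrymWeilLine

open Literature.AlgebraicGeometry.Motives Literature.AlgebraicGeometry.HodgeTheory
open Literature.AlgebraicTopology.SingularHomology
open scoped MonObj

variable {A B : AbelianVariety ℂ}

/-! ## The neutral element and `H⁰` -/

/-- **The zero homomorphism kills positive-degree cohomology**: `0^* w = 0` for `w ∈ Hʲ(A(ℂ); ℂ)`,
`j > 0`, because `0 = (B → Spec ℂ → A)` and `Hʲ(Spec ℂ (ℂ); ℂ) = 0` (`Spec ℂ` is smooth projective
of dimension `0`). [cite: MumfordAV1970, §1] -/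
theorem pca_map_zero_of_pos {j : ℕ} (hj : 0 < j) (w : complexBetti A.X j) :
    complexBetti.map (0 : B ⟶ A).hom.hom.hom j w = 0 := by
  haveI := subsingleton_complexBetti (isSmoothProjective_unit_holds ℂ) (k := j) (by omega)
  change complexBetti.map (toUnit B.X ≫ η[A.X]) j w = 0
  rw [complexBetti.map_comp]
  change complexBetti.map (toUnit B.X) j (complexBetti.map η[A.X] j w) = 0
  rw [Subsingleton.elim (complexBetti.map η[A.X] j w) 0, map_zero]

/-- **The zero endomorphism is the identity on `H⁰(A(ℂ); ℂ) = ℂ · 1`** (`A(ℂ)` is path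
connected and pull-backs preserve the unit). [cite: HatcherAT2002, §3.1 p. 199 and Prop. 3.10] -/
theorem pca_map_zero_of_eq_zero {j : ℕ} (hj : j = 0) (w : complexBetti A.X j) :
    complexBetti.map (0 : A ⟶ A).hom.hom.hom j w = w := by
  subst hj
  rw [eq_smul_one_of_pathConnectedSpace w, map_smul]
  congr 1
  exact singularCohomology.map_one _

/-! ## The coproduct formula -/

/-- **The coproduct formula** (Mumford §1): for `y ∈ Hᵈ(A(ℂ); ℂ)` write
`m^* y = Σᵢ pr₁^* y'ᵢ ∪ pr₂^* y''ᵢ` by the Künneth spanning theorem for `(A × A)(ℂ)`; then for all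
homomorphisms `f, g : B ⟶ A` of complex abelian varieties, `f + g = ⟨f, g⟩ ≫ m` gives
`(f + g)^* y = Σᵢ f^* y'ᵢ ∪ g^* y''ᵢ`. [cite: MumfordAV1970, §1] [cite: HatcherAT2002, §3.2 Thm. 3.15] -/
theorem pca_coprod (A : AbelianVariety ℂ) (d : ℕ) (y : complexBetti A.X d) :
    ∃ (n : ℕ) (a b : Fin n → ℕ) (hab : ∀ i, a i + b i = d)
      (y₁ : (i : Fin n) → complexBetti A.X (a i)) (y₂ : (i : Fin n) → complexBetti A.X (b i)),
      ∀ (B : AbelianVariety ℂ) (f g : B ⟶ A),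
        complexBetti.map (f + g).hom.hom.hom d y =
          ∑ i, cupProduct (hab i) (complexBetti.map f.hom.hom.hom (a i) (y₁ i))
            (complexBetti.map g.hom.hom.hom (b i) (y₂ i)) := by
  classical
  have hA : IsSmoothProjective A.dim A.X := AbelianVariety.isSmoothProjective_holds
  obtain ⟨cf, t, ht, -, hsum⟩ := Submodule.mem_span_iff_exists_finset_subset.mp
    (kunnethSpan_complexBetti hA hA d (complexBetti.map μ[A.X] d y))
  have ht' : ∀ v ∈ t, ∃ (i j : ℕ) (h : i + j = d) (b : complexBetti A.X i) (w : complexBetti A.X j),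
      v = cupProduct h (complexBetti.map (fst A.X A.X) i b) (complexBetti.map (snd A.X A.X) j w) :=
    fun v hv ↦ ht hv
  choose! i j hij b w hv using ht'
  let e := t.equivFin
  refine ⟨t.card, fun k ↦ i (e.symm k), fun k ↦ j (e.symm k), fun k ↦ hij _ (e.symm k).2,
    fun k ↦ cf (e.symm k) • b (e.symm k), fun k ↦ w (e.symm k), fun B f g ↦ ?_⟩
  -- `(f + g)^* y = ⟨f, g⟩^* m^* y`
  have hfg : complexBetti.map (f + g).hom.hom.hom d y =
      complexBetti.map (lift f.hom.hom.hom g.hom.hom.hom) d (complexBetti.map μ[A.X] d y) := by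
    change complexBetti.map (lift f.hom.hom.hom g.hom.hom.hom ≫ μ[A.X]) d y = _
    rw [complexBetti.map_comp]
    rfl
  -- termwise: `⟨f, g⟩^* (c • (pr₁^* b ∪ pr₂^* w)) = f^* (c • b) ∪ g^* w`
  have key : ∀ (v : complexBetti (A.X ⊗ A.X) d) (hvt : v ∈ t),
      complexBetti.map (lift f.hom.hom.hom g.hom.hom.hom) d (cf v • v) =
        cupProduct (hij v hvt) (complexBetti.map f.hom.hom.hom (i v) (cf v • b v))
          (complexBetti.map g.hom.hom.hom (j v) (w v)) := by
    intro v hvt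
    rw [show cf v • v = cf v • cupProduct (hij v hvt) (complexBetti.map (fst A.X A.X) (i v) (b v))
      (complexBetti.map (snd A.X A.X) (j v) (w v)) from congrArg (cf v • ·) (hv v hvt),
      map_smul, cupProduct_map, map_smul, LinearMap.map_smul₂]
    change cf v • cupProduct (hij v hvt)
        (complexBetti.map (lift f.hom.hom.hom g.hom.hom.hom) (i v)
          (complexBetti.map (fst A.X A.X) (i v) (b v)))
        (complexBetti.map (lift f.hom.hom.hom g.hom.hom.hom) (j v)
          (complexBetti.map (snd A.X A.X) (j v) (w v))) = _
    rw [← CategoryTheory.comp_apply, ← complexBetti.map_comp, lift_fst,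
      ← CategoryTheory.comp_apply, ← complexBetti.map_comp, lift_snd]
  rw [hfg, ← hsum, map_sum, ← Finset.sum_coe_sort t, ← Equiv.sum_comp e.symm]
  exact Finset.sum_congr rfl fun k _ ↦ key _ (e.symm k).2

/-! ## `n ↦ [n]^*` is polynomial -/

/-- **`n ↦ [n]^* y` is a polynomial function of `n ∈ ℕ`** with coefficients in `Hᵈ(A(ℂ); ℂ)`, for
every class `y` of every degree `d` on a complex abelian variety (the degree-free shadow of
`[n]^* = nᵈ`, Mumford §1 / Kleiman 1968 2A, proved on the real carriers by induction on `d` from the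
coproduct formula and Faulhaber). [cite: MumfordAV1970, §1] -/
theorem pca_nsmul_poly (A : AbelianVariety ℂ) (d : ℕ) (y : complexBetti A.X d) :
    ∃ ω : ℕ →₀ complexBetti A.X d, ∀ n : ℕ,
      complexBetti.map (n • 𝟙 A).hom.hom.hom d y = ω.sum (fun e v ↦ ((n : ℂ) ^ e) • v) := by
  induction d using Nat.strong_induction_on with
  | _ d IH =>
  obtain ⟨N, a, b, hab, y₁, y₂, H⟩ := pca_coprod A d y
  -- the recursion `[n+1]^* y = [n]^* y + D n`
  have hstep : ∀ n : ℕ, complexBetti.map ((n + 1) • 𝟙 A).hom.hom.hom d y =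
      complexBetti.map (n • 𝟙 A).hom.hom.hom d y +
        ∑ i ∈ Finset.univ.filter (fun i ↦ b i ≠ 0), cupProduct (hab i)
          (complexBetti.map (n • 𝟙 A).hom.hom.hom (a i) (y₁ i)) (y₂ i) := by
    intro n
    have h1 := H A (n • 𝟙 A) (𝟙 A)
    have h0 := H A (n • 𝟙 A) 0
    rw [add_zero] at h0
    have hid : ∀ i, complexBetti.map (𝟙 A : A ⟶ A).hom.hom.hom (b i) (y₂ i) = y₂ i := by
      intro i
      change complexBetti.map (𝟙 A.X) (b i) (y₂ i) = y₂ i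
      rw [complexBetti.map_id]
      rfl
    simp_rw [hid] at h1
    -- the terms with `bᵢ ≠ 0` of `[n]^* y` vanish, the others are those of `[n+1]^* y`
    have hzero : ∑ i ∈ Finset.univ.filter (fun i ↦ b i ≠ 0), cupProduct (hab i)
        (complexBetti.map (n • 𝟙 A).hom.hom.hom (a i) (y₁ i))
        (complexBetti.map (0 : A ⟶ A).hom.hom.hom (b i) (y₂ i)) = 0 := by
      refine Finset.sum_eq_zero fun i hi ↦ ?_
      rw [pca_map_zero_of_pos (Nat.pos_of_ne_zero (Finset.mem_filter.mp hi).2), map_zero]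
    have hz : ∀ i ∈ Finset.univ.filter (fun i ↦ ¬ b i ≠ 0),
        cupProduct (hab i) (complexBetti.map (n • 𝟙 A).hom.hom.hom (a i) (y₁ i))
          (complexBetti.map (0 : A ⟶ A).hom.hom.hom (b i) (y₂ i)) =
        cupProduct (hab i) (complexBetti.map (n • 𝟙 A).hom.hom.hom (a i) (y₁ i)) (y₂ i) :=
      fun i hi ↦ by rw [pca_map_zero_of_eq_zero (not_not.mp (Finset.mem_filter.mp hi).2) (y₂ i)]
    rw [succ_nsmul, h1, h0,
      ← Finset.sum_filter_add_sum_filter_not Finset.univ (fun i ↦ b i ≠ 0)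
        (fun i ↦ cupProduct (hab i) (complexBetti.map (n • 𝟙 A).hom.hom.hom (a i) (y₁ i)) (y₂ i)),
      ← Finset.sum_filter_add_sum_filter_not Finset.univ (fun i ↦ b i ≠ 0)
        (fun i ↦ cupProduct (hab i) (complexBetti.map (n • 𝟙 A).hom.hom.hom (a i) (y₁ i))
          (complexBetti.map (0 : A ⟶ A).hom.hom.hom (b i) (y₂ i))),
      hzero, zero_add, Finset.sum_congr rfl hz, add_comm]
  refine pca_poly_of_succ hstep (pca_poly_sum _ _ fun i hi ↦ ?_)
  have hai : a i < d := by
    have := hab i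
    have hbi := (Finset.mem_filter.mp hi).2
    omega
  exact pca_poly_map ((cupProduct (hab i)).flip (y₂ i)) (IH (a i) hai (y₁ i))

/-! ## Two-parameter families -/

/-- `(n • f)^* x = f^* ([n]^* x)` (`n • f = f ≫ n • 𝟙`, bilinearity of composition).
[cite: MumfordAV1970, §19] -/
theorem pca_map_nsmul (f : B ⟶ A) (n k : ℕ) (x : complexBetti A.X k) :
    complexBetti.map (n • f).hom.hom.hom k x =
      complexBetti.map f.hom.hom.hom k (complexBetti.map (n • 𝟙 A).hom.hom.hom k x) := by
  have h : n • f = f ≫ (n • 𝟙 A) := by rw [Preadditive.comp_nsmul, Category.comp_id]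
  rw [h]
  change complexBetti.map (f.hom.hom.hom ≫ (n • 𝟙 A).hom.hom.hom) k x = _
  rw [complexBetti.map_comp]
  rfl

/-- **`(u, w) ↦ (f₀ + u·f₁ + w·f₂)^* c` is a polynomial function on `ℕ × ℕ`** with coefficients
in `Hᵈ(B(ℂ); ℂ)`, for homomorphisms `f₀ f₁ f₂ : B ⟶ A` of complex abelian varieties and
`c ∈ Hᵈ(A(ℂ); ℂ)` (coproduct formula twice and polynomiality of `[n]^*`).
[cite: MumfordAV1970, §1] -/
theorem pca_poly₂_map_add (f₀ f₁ f₂ : B ⟶ A) (d : ℕ) (c : complexBetti A.X d) :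
    ∃ r : (ℕ × ℕ) →₀ complexBetti B.X d, ∀ u w : ℕ,
      complexBetti.map (f₀ + u • f₁ + w • f₂).hom.hom.hom d c =
        r.sum (fun x v ↦ (((u : ℂ) ^ x.1) * ((w : ℂ) ^ x.2)) • v) := by
  obtain ⟨N, a, b, hab, c₁, c₂, H⟩ := pca_coprod A d c
  suffices h : ∃ r : (ℕ × ℕ) →₀ complexBetti B.X d, ∀ u w : ℕ,
      (∑ i, cupProduct (hab i) (complexBetti.map (f₀ + u • f₁).hom.hom.hom (a i) (c₁ i))
        (complexBetti.map (w • f₂).hom.hom.hom (b i) (c₂ i))) =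
        r.sum (fun x v ↦ (((u : ℂ) ^ x.1) * ((w : ℂ) ^ x.2)) • v) by
    obtain ⟨r, hr⟩ := h
    exact ⟨r, fun u w ↦ (H B _ _).trans (hr u w)⟩
  refine pca_poly₂_sum _ _ fun i _ ↦ pca_poly₂_bilin (cupProduct (hab i))
    (F := fun u ↦ complexBetti.map (f₀ + u • f₁).hom.hom.hom (a i) (c₁ i))
    (G := fun w ↦ complexBetti.map (w • f₂).hom.hom.hom (b i) (c₂ i)) ?_ ?_
  · -- `u ↦ (f₀ + u·f₁)^* c₁ᵢ = Σⱼ f₀^* c'ⱼ ∪ f₁^* [u]^* c''ⱼ`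
    obtain ⟨N', a', b', hab', c₁₁, c₁₂, H'⟩ := pca_coprod A (a i) (c₁ i)
    suffices h : ∃ ω : ℕ →₀ complexBetti B.X (a i), ∀ u : ℕ,
        (∑ j, cupProduct (hab' j) (complexBetti.map f₀.hom.hom.hom (a' j) (c₁₁ j))
          (complexBetti.map f₁.hom.hom.hom (b' j)
            (complexBetti.map (u • 𝟙 A).hom.hom.hom (b' j) (c₁₂ j)))) =
          ω.sum (fun e x ↦ ((u : ℂ) ^ e) • x) by
      obtain ⟨ω, hω⟩ := h
      refine ⟨ω, fun u ↦ ((H' B f₀ (u • f₁)).trans ?_).trans (hω u)⟩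
      exact Finset.sum_congr rfl fun j _ ↦ by rw [pca_map_nsmul f₁]
    exact pca_poly_sum _ _ fun j _ ↦ pca_poly_map
      ((cupProduct (hab' j) (complexBetti.map f₀.hom.hom.hom (a' j) (c₁₁ j))) ∘ₗ
        (complexBetti.map f₁.hom.hom.hom (b' j)).hom) (pca_nsmul_poly A (b' j) (c₁₂ j))
  · -- `w ↦ (w·f₂)^* c₂ᵢ = f₂^* [w]^* c₂ᵢ`
    obtain ⟨ω, hω⟩ := pca_poly_map (complexBetti.map f₂.hom.hom.hom (b i)).hom
      (pca_nsmul_poly A (b i) (c₂ i))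
    exact ⟨ω, fun w ↦ (pca_map_nsmul f₂ w (b i) (c₂ i)).trans (hω w)⟩

/-- **Registered sub-goal form of `pca_poly₂_map_add`** (stub `pca_stub_polyPullback` of crux
`HeckePrymAnchors`, serving `stub_pointClassAnchor`): polynomiality of `(f₀ + u·f₁ + w·f₂)^*` on
the complex cohomology of complex abelian varieties, fully quantified. [cite: MumfordAV1970, §1] -/
theorem pca_stub_polyPullback :
    ∀ (A B : AbelianVariety ℂ) (f₀ f₁ f₂ : B ⟶ A) (d : ℕ) (c : complexBetti A.X d),
      ∃ r : (ℕ × ℕ) →₀ complexBetti B.X d, ∀ u w : ℕ,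
        complexBetti.map (f₀ + u • f₁ + w • f₂).hom.hom.hom d c =
          r.sum (fun x v ↦ ((u : ℂ) ^ x.1 * (w : ℂ) ^ x.2) • v) :=
  fun _ _ f₀ f₁ f₂ d c ↦ pca_poly₂_map_add f₀ f₁ f₂ d c

end Summit.HodgeConjecture.HodgeConjecture.Theorems.HeckePrymWeilLine

end
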